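import Mathlib.Topology.Algebra.InfiniteSum.Real
import Mathlib.Topology.Algebra.InfiniteSum.Order
import HarnessLib

/-!
# The top of a square-summable family with a positive least upper bound is attained
(stub `stub_exists_top_index` of line `twisted_trace_transfer`, crux `QuarksAsStableAction.StableActionBridge`,
stmt-QuantumFields-9737; sub-goal D2 of step E3)

Abstract lemma: if `Σ λᵢ² < ∞`, `λᵢ ≤ s` for all `i`, `0 < s`, and `s` is the least upper bound of the `λᵢ`
(`∀ Λ, (∀ i, λᵢ ≤ Λ) → s ≤ Λ`), then `λ_{i₀} = s` for some `i₀`.  In E3 the `λᵢ` are the eigenvalues of the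
compact positive transfer operator of lattice QCD (square-summable by Hilbert–Schmidt) and `s` is the tree's top
min–max level; the lemma says the top eigenvalue is attained.

Proof.  `ι` is nonempty (otherwise every real is an upper bound, so `s ≤ 0`).  Square-summability gives
`λᵢ² → 0` along `cofinite` (`Summable.tendsto_cofinite_zero`), so eventually `λᵢ² < (s/2)²`, whence `λᵢ < s/2`;
thus `T := {i | s/2 < λᵢ}` is finite.  Pick `a` with `λ_b ≤ λ_a` for all `b ∈ T` (`Set.exists_upper_bound_image`).
Then `max λ_a (s/2)` bounds every `λᵢ`, so `s ≤ max λ_a (s/2)`; as `s/2 < s` this forces `s ≤ λ_a ≤ s`.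
Mathlib only. [folklore]
-/

open Filter

namespace Summit.QuantumFields.QCD.Cruxes.StableActionBridge.TwistedTraceTransfer

namespace StubExistsTopIndex

/-- For a real family with `Σ λᵢ² < ∞` and `0 < t`, only finitely many indices satisfy `t < λᵢ`
(divergence test along `cofinite`). [folklore] -/
theorem finite_setOf_lt {ι : Type*} (lam : ι → ℝ) {t : ℝ} (ht : 0 < t)
    (hsum : Summable (fun i => lam i ^ 2)) : {i | t < lam i}.Finite := by
  have hev : ∀ᶠ i in cofinite, lam i ^ 2 < t ^ 2 :=
    hsum.tendsto_cofinite_zero.eventually_lt_const (by positivity)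
  refine (Filter.eventually_cofinite.1 hev).subset fun i hi => ?_
  simp only [Set.mem_setOf_eq] at hi ⊢
  intro hlt
  exact absurd ((le_abs_self _).trans_lt (abs_lt_of_sq_lt_sq hlt ht.le)) (not_lt.mpr hi.le)

end StubExistsTopIndex

/-- **Sub-goal D2 of E3 (abstract): a square-summable family whose least upper bound `s > 0` is attained.**
If `Σ λᵢ² < ∞`, `λᵢ ≤ s` for all `i`, `0 < s`, and `s` is the least upper bound of the `λᵢ`
(`∀ Λ, (∀ i, λᵢ ≤ Λ) → s ≤ Λ`), then `λ_{i₀} = s` for some `i₀` (only finitely many `λᵢ` exceed `s/2`,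
and the largest of those must equal `s`). [folklore] -/
theorem stub_exists_top_index : ∀ (ι : Type) (lam : ι → ℝ) (s : ℝ), 0 < s → Summable (fun i => lam i ^ 2) →
    (∀ i, lam i ≤ s) → (∀ Λ : ℝ, (∀ i, lam i ≤ Λ) → s ≤ Λ) → ∃ i₀, lam i₀ = s := by
  intro ι lam s hs hsum hub hleast
  rcases isEmpty_or_nonempty ι with hι | hι
  · exact absurd (hleast 0 fun i => (hι.false i).elim) (not_le.mpr hs)
  obtain ⟨a, ha⟩ :=
    Set.exists_upper_bound_image {i | s / 2 < lam i} lam (StubExistsTopIndex.finite_setOf_lt lam (half_pos hs) hsum)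
  refine ⟨a, le_antisymm (hub a) ?_⟩
  have hΛ : s ≤ max (lam a) (s / 2) := by
    refine hleast _ fun i => ?_
    by_cases hi : s / 2 < lam i
    · exact (ha i hi).trans (le_max_left _ _)
    · exact (not_lt.mp hi).trans (le_max_right _ _)
  rcases le_max_iff.mp hΛ with h | h
  · exact h
  · exact absurd h (not_le.mpr (half_lt_self hs))

end Summit.QuantumFields.QCD.Cruxes.StableActionBridge.TwistedTraceTransfer
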